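import Summits.MatrixMultiplication.MatrixMultiplication.Theorems.SoloBlindCorankOneKraft
import Summits.MatrixMultiplication.MatrixMultiplication.Theorems.SoloBlindTwist

/-!
# Signed sum-distinctness in exponent three, zero-sum kills, masses on a sum-distinct set

Sub-programme (K₃) / Conjecture E — tools for the corank-two certificates (`SoloBlindCorankTwoKraft`).
`B` is SUM-DISTINCT for `h : ι → G` when distinct subsets of `B` have distinct `h`-sums.

* `soloBlind_signed_sumDistinct` — in a group of exponent `3` a sum-distinct `B` is SIGNED sum-distinct: for
  disjoint pairs `(A⁺, A⁻)`, `(C⁺, C⁻)` of subsets of `B`, `∑A⁺ - ∑A⁻ = ∑C⁺ - ∑C⁻` forces `A⁺ = C⁺` and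
  `A⁻ = C⁻`.  Induction on the crossing number `|A⁺ ∩ C⁻| + |C⁺ ∩ A⁻|` (`soloBlind_signed_sumDistinct_aux`): a
  crossing element `x` is moved across with `-x = x + x` (`soloBlind_three_move`), which lowers the crossing number
  and yields an impossible identity; without crossings it is plain sum-distinctness of `A⁺ ∪ C⁻` and `C⁺ ∪ A⁻`.
  Over `𝔽₃` this is 'sum-distinct ⟹ linearly independent'.
* `soloBlind_kill_one`, `soloBlind_kill_two` — a subset of `B` plus one or two elements outside `B` is not a
  zero-sum; `soloBlind_kill_P2`, `soloBlind_kill_P4`, `soloBlind_kill_P5` — the three value patterns excluded in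
  the corank-two analysis (P2 by a zero-sum in exponent `3`, P4 and P5 by signed sum-distinctness).
* `soloBlind_mass_le_pow_of_rep` (with `soloBlind_mass_nonneg` of `SoloBlindTwist`), `soloBlind_mass_le_one_of_sumDistinct`,
  `soloBlind_mass_eq_zero_of_repAll_eq_empty` — Kraft masses `K_B(x)` on a sum-distinct `B` are `0` or `2^{-|A|}`.
-/

namespace Summit.MatrixMultiplication.MatrixMultiplication.Theorems

open Finset

universe u

variable {ι : Type*} [DecidableEq ι]
variable {G : Type u} [AddCommGroup G] [DecidableEq G]

/-! ## Signed sum-distinctness in exponent three -/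

omit [DecidableEq G] in
/-- Exponent-`3` arithmetic for moving a crossing element: from `A - A' = C - C'` to
`(A - x) - (x + A') = C - (C' - x)`. -/
theorem soloBlind_three_move (three : ∀ g : G, g + g + g = 0) {sA sA' sC sC' x : G}
    (e : sA - sA' = sC - sC') : sA - x - (x + sA') = sC - (sC' - x) := by
  have key : sA - x - (x + sA') - (sC - (sC' - x)) = (sA - sA' - (sC - sC')) - (x + x + x) := by abel
  rw [sub_eq_zero.mpr e, three, sub_zero] at key
  exact sub_eq_zero.mp key

omit [DecidableEq G] in
/-- SIGNED SUM-DISTINCTNESS (exponent `3`), with the crossing number as induction parameter. -/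
theorem soloBlind_signed_sumDistinct_aux (three : ∀ g : G, g + g + g = 0) {h : ι → G} {B : Finset ι}
    (hdist : ∀ A ⊆ B, ∀ A' ⊆ B, ∑ i ∈ A, h i = ∑ i ∈ A', h i → A = A') :
    ∀ (n : ℕ) (Ap Am Cp Cm : Finset ι), (Ap ∩ Cm).card + (Cp ∩ Am).card = n →
      Ap ⊆ B → Am ⊆ B → Cp ⊆ B → Cm ⊆ B → Disjoint Ap Am → Disjoint Cp Cm →
      ∑ i ∈ Ap, h i - ∑ i ∈ Am, h i = ∑ i ∈ Cp, h i - ∑ i ∈ Cm, h i → Ap = Cp ∧ Am = Cm := by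
  intro n
  induction n with
  | zero =>
    intro Ap Am Cp Cm hn hAp hAm hCp hCm hdA hdC e
    have h1 : Disjoint Ap Cm := by
      rw [Finset.disjoint_iff_inter_eq_empty, ← Finset.card_eq_zero]; omega
    have h2 : Disjoint Cp Am := by
      rw [Finset.disjoint_iff_inter_eq_empty, ← Finset.card_eq_zero]; omega
    have e' : ∑ i ∈ Ap ∪ Cm, h i = ∑ i ∈ Cp ∪ Am, h i := by
      rw [Finset.sum_union h1, Finset.sum_union h2]
      exact sub_eq_sub_iff_add_eq_add.mp e
    have hU := hdist _ (Finset.union_subset hAp hCm) _ (Finset.union_subset hCp hAm) e'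
    refine ⟨?_, ?_⟩
    · ext x
      constructor
      · intro hx
        have hx' : x ∈ Cp ∪ Am := hU ▸ Finset.mem_union_left _ hx
        rcases Finset.mem_union.mp hx' with h' | h'
        · exact h'
        · exact absurd h' (Finset.disjoint_left.mp hdA hx)
      · intro hx
        have hx' : x ∈ Ap ∪ Cm := hU.symm ▸ Finset.mem_union_left _ hx
        rcases Finset.mem_union.mp hx' with h' | h'
        · exact h'
        · exact absurd h' (Finset.disjoint_left.mp hdC hx)
    · ext x
      constructor
      · intro hx
        have hx' : x ∈ Ap ∪ Cm := hU.symm ▸ Finset.mem_union_right _ hx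
        rcases Finset.mem_union.mp hx' with h' | h'
        · exact absurd hx (Finset.disjoint_left.mp hdA h')
        · exact h'
      · intro hx
        have hx' : x ∈ Cp ∪ Am := hU ▸ Finset.mem_union_right _ hx
        rcases Finset.mem_union.mp hx' with h' | h'
        · exact absurd hx (Finset.disjoint_left.mp hdC h')
        · exact h'
  | succ k ih =>
    intro Ap Am Cp Cm hn hAp hAm hCp hCm hdA hdC e
    exfalso
    by_cases hX : (Ap ∩ Cm).Nonempty
    · -- move a crossing element `x ∈ A⁺ ∩ C⁻` from `A⁺` to `A⁻` and delete it from `C⁻`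
      obtain ⟨x, hx⟩ := hX
      have hxAp : x ∈ Ap := (Finset.mem_inter.mp hx).1
      have hxCm : x ∈ Cm := (Finset.mem_inter.mp hx).2
      have hxAm : x ∉ Am := Finset.disjoint_left.mp hdA hxAp
      have hxCp : x ∉ Cp := fun h' => Finset.disjoint_left.mp hdC h' hxCm
      have hmeasure : (Ap.erase x ∩ Cm.erase x).card + (Cp ∩ insert x Am).card = k := by
        have e1 : Ap.erase x ∩ Cm.erase x = (Ap ∩ Cm).erase x := by
          ext y
          simp only [Finset.mem_inter, Finset.mem_erase]
          tauto
        have e2 : Cp ∩ insert x Am = Cp ∩ Am := by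
          ext y
          simp only [Finset.mem_inter, Finset.mem_insert]
          constructor
          · rintro ⟨hy1, hy2 | hy2⟩
            · exact absurd hy1 (hy2 ▸ hxCp)
            · exact ⟨hy1, hy2⟩
          · rintro ⟨hy1, hy2⟩
            exact ⟨hy1, Or.inr hy2⟩
        rw [e1, e2, Finset.card_erase_of_mem hx]
        have hpos : 0 < (Ap ∩ Cm).card := Finset.card_pos.mpr ⟨x, hx⟩
        omega
      have e' : ∑ i ∈ Ap.erase x, h i - ∑ i ∈ insert x Am, h i =
          ∑ i ∈ Cp, h i - ∑ i ∈ Cm.erase x, h i := by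
        rw [Finset.sum_erase_eq_sub hxAp, Finset.sum_insert hxAm, Finset.sum_erase_eq_sub hxCm]
        exact soloBlind_three_move three e
      have hdA' : Disjoint (Ap.erase x) (insert x Am) := by
        rw [Finset.disjoint_insert_right]
        exact ⟨Finset.notMem_erase x Ap, hdA.mono_left (Finset.erase_subset x Ap)⟩
      have hdC' : Disjoint Cp (Cm.erase x) := hdC.mono_right (Finset.erase_subset x Cm)
      obtain ⟨-, h2⟩ := ih _ _ _ _ hmeasure ((Finset.erase_subset x Ap).trans hAp)
        (Finset.insert_subset (hAp hxAp) hAm) hCp ((Finset.erase_subset x Cm).trans hCm) hdA' hdC' e'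
      have hmem : x ∈ Cm.erase x := h2 ▸ Finset.mem_insert_self x Am
      exact Finset.notMem_erase x Cm hmem
    · -- otherwise a crossing element `x ∈ C⁺ ∩ A⁻`: the symmetric move
      have hY : (Cp ∩ Am).Nonempty := by
        rw [Finset.not_nonempty_iff_eq_empty] at hX
        rw [hX, Finset.card_empty] at hn
        exact Finset.card_pos.mp (by omega)
      obtain ⟨x, hx⟩ := hY
      have hxCp : x ∈ Cp := (Finset.mem_inter.mp hx).1
      have hxAm : x ∈ Am := (Finset.mem_inter.mp hx).2
      have hxCm : x ∉ Cm := Finset.disjoint_left.mp hdC hxCp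
      have hxAp : x ∉ Ap := fun h' => Finset.disjoint_left.mp hdA h' hxAm
      have hmeasure : (Ap ∩ insert x Cm).card + (Cp.erase x ∩ Am.erase x).card = k := by
        have e1 : Cp.erase x ∩ Am.erase x = (Cp ∩ Am).erase x := by
          ext y
          simp only [Finset.mem_inter, Finset.mem_erase]
          tauto
        have e2 : Ap ∩ insert x Cm = Ap ∩ Cm := by
          ext y
          simp only [Finset.mem_inter, Finset.mem_insert]
          constructor
          · rintro ⟨hy1, hy2 | hy2⟩
            · exact absurd hy1 (hy2 ▸ hxAp)
            · exact ⟨hy1, hy2⟩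
          · rintro ⟨hy1, hy2⟩
            exact ⟨hy1, Or.inr hy2⟩
        rw [e1, e2, Finset.card_erase_of_mem hx]
        have hpos : 0 < (Cp ∩ Am).card := Finset.card_pos.mpr ⟨x, hx⟩
        omega
      have e' : ∑ i ∈ Ap, h i - ∑ i ∈ Am.erase x, h i =
          ∑ i ∈ Cp.erase x, h i - ∑ i ∈ insert x Cm, h i := by
        rw [Finset.sum_erase_eq_sub hxAm, Finset.sum_insert hxCm, Finset.sum_erase_eq_sub hxCp]
        have := soloBlind_three_move three e.symm (x := h x)
        exact this.symm
      have hdC' : Disjoint (Cp.erase x) (insert x Cm) := by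
        rw [Finset.disjoint_insert_right]
        exact ⟨Finset.notMem_erase x Cp, hdC.mono_left (Finset.erase_subset x Cp)⟩
      have hdA' : Disjoint Ap (Am.erase x) := hdA.mono_right (Finset.erase_subset x Am)
      obtain ⟨-, h2⟩ := ih _ _ _ _ hmeasure hAp ((Finset.erase_subset x Am).trans hAm)
        ((Finset.erase_subset x Cp).trans hCp) (Finset.insert_subset (hCp hxCp) hCm) hdA' hdC' e'
      have hmem : x ∈ Am.erase x := h2.symm ▸ Finset.mem_insert_self x Cm
      exact Finset.notMem_erase x Am hmem

omit [DecidableEq G] in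
/-- SIGNED SUM-DISTINCTNESS in exponent `3`: disjoint pairs `(A⁺, A⁻)`, `(C⁺, C⁻)` of subsets of a sum-distinct `B`
with `∑A⁺ - ∑A⁻ = ∑C⁺ - ∑C⁻` coincide. -/
theorem soloBlind_signed_sumDistinct (three : ∀ g : G, g + g + g = 0) {h : ι → G} {B : Finset ι}
    (hdist : ∀ A ⊆ B, ∀ A' ⊆ B, ∑ i ∈ A, h i = ∑ i ∈ A', h i → A = A')
    {Ap Am Cp Cm : Finset ι} (hAp : Ap ⊆ B) (hAm : Am ⊆ B) (hCp : Cp ⊆ B) (hCm : Cm ⊆ B)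
    (hdA : Disjoint Ap Am) (hdC : Disjoint Cp Cm)
    (e : ∑ i ∈ Ap, h i - ∑ i ∈ Am, h i = ∑ i ∈ Cp, h i - ∑ i ∈ Cm, h i) : Ap = Cp ∧ Am = Cm :=
  soloBlind_signed_sumDistinct_aux three hdist _ Ap Am Cp Cm rfl hAp hAm hCp hCm hdA hdC e

/-! ## Zero-sum kills -/

omit [DecidableEq G] in
/-- A subset of `B` plus one outside element cannot sum to zero. -/
theorem soloBlind_kill_one {h : ι → G} {S B : Finset ι}
    (zsf : ∀ T ⊆ S, T.Nonempty → ∑ i ∈ T, h i ≠ 0) (hBS : B ⊆ S) {x : ι} (hxS : x ∈ S) (hxB : x ∉ B)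
    {A : Finset ι} (hA : A ⊆ B) (e : ∑ i ∈ A, h i + h x = 0) : False :=
  zsf (insert x A) (Finset.insert_subset hxS (hA.trans hBS)) (Finset.insert_nonempty x A)
    (by rw [Finset.sum_insert (fun hx => hxB (hA hx)), add_comm, e])

omit [DecidableEq G] in
/-- A subset of `B` plus two outside elements cannot sum to zero. -/
theorem soloBlind_kill_two {h : ι → G} {S B : Finset ι}
    (zsf : ∀ T ⊆ S, T.Nonempty → ∑ i ∈ T, h i ≠ 0) (hBS : B ⊆ S) {x y : ι} (hxS : x ∈ S) (hyS : y ∈ S)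
    (hxB : x ∉ B) (hyB : y ∉ B) (hxy : x ≠ y) {A : Finset ι} (hA : A ⊆ B)
    (e : ∑ i ∈ A, h i + h x + h y = 0) : False := by
  have hx' : x ∉ insert y A := by
    intro hx
    rcases Finset.mem_insert.mp hx with hx | hx
    · exact hxy hx
    · exact hxB (hA hx)
  refine zsf (insert x (insert y A))
    (Finset.insert_subset hxS (Finset.insert_subset hyS (hA.trans hBS))) (Finset.insert_nonempty x _) ?_
  rw [Finset.sum_insert hx', Finset.sum_insert (fun hy => hyB (hA hy))]
  have key : h x + (h y + ∑ i ∈ A, h i) = ∑ i ∈ A, h i + h x + h y := by abel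
  rw [key]
  exact e

omit [DecidableEq G] in
/-- Pattern P2: an element `s ∈ B` of value `h p` together with a `B`-representation of `h s - h q` is impossible
(exponent `3`). -/
theorem soloBlind_kill_P2 (three : ∀ g : G, g + g + g = 0) {h : ι → G} {S B : Finset ι}
    (zsf : ∀ T ⊆ S, T.Nonempty → ∑ i ∈ T, h i ≠ 0) (hBS : B ⊆ S) {p q : ι} (hpS : p ∈ S) (hqS : q ∈ S)
    (hpB : p ∉ B) (hqB : q ∉ B) (hpq : p ≠ q) {s : ι} (hs : s ∈ B) (hps : h p = h s)
    {A : Finset ι} (hA : A ⊆ B) (e : ∑ i ∈ A, h i = h s - h q) : False := by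
  by_cases hsA : s ∈ A
  · refine soloBlind_kill_one zsf hBS hqS hqB ((Finset.erase_subset s A).trans hA) ?_
    rw [Finset.sum_erase_eq_sub hsA, e]
    abel
  · refine soloBlind_kill_two zsf hBS hpS hqS hpB hqB hpq (Finset.insert_subset hs hA) ?_
    rw [Finset.sum_insert hsA, e, hps]
    have key : h s + (h s - h q) + h s + h q = h s + h s + h s := by abel
    rw [key]
    exact three (h s)

omit [DecidableEq G] in
/-- Pattern P4: values `h s = τ`, `h s₁ = τ - h p`, `h s₂ = τ - h q` on `B` together with a `B`-representation of
`τ - h q - h p` is impossible (signed sum-distinctness). -/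
theorem soloBlind_kill_P4 (three : ∀ g : G, g + g + g = 0) {h : ι → G} {B : Finset ι}
    (hdist : ∀ A ⊆ B, ∀ A' ⊆ B, ∑ i ∈ A, h i = ∑ i ∈ A', h i → A = A')
    {p q : ι} (ha : h p ≠ 0) (hb : h q ≠ 0) {τ : G} {s s₁ s₂ : ι} (hsB : s ∈ B) (hs₁B : s₁ ∈ B)
    (hs₂B : s₂ ∈ B) (hs : h s = τ) (hs₁ : h s₁ = τ - h p) (hs₂ : h s₂ = τ - h q)
    {A : Finset ι} (hA : A ⊆ B) (e : ∑ i ∈ A, h i = τ - h q - h p) : False := by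
  have hss₁ : s ≠ s₁ := by
    intro hss
    apply ha
    have e₁ := hs₁
    rw [← hss, hs] at e₁
    exact sub_eq_self.mp e₁.symm
  have hss₂ : s ≠ s₂ := by
    intro hss
    apply hb
    have e₂ := hs₂
    rw [← hss, hs] at e₂
    exact sub_eq_self.mp e₂.symm
  by_cases h₁₂ : s₁ = s₂
  · -- `a = b`: `∑A = -(h s₁ + h s)`, i.e. `(A, ∅)` against `(∅, {s₁, s})`
    subst h₁₂
    have hpq : h q = h p := by
      have e₁₂ : τ - h p = τ - h q := hs₁.symm.trans hs₂
      exact (sub_right_inj.mp e₁₂).symm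
    have e' : ∑ i ∈ A, h i - ∑ i ∈ (∅ : Finset ι), h i =
        ∑ i ∈ (∅ : Finset ι), h i - ∑ i ∈ ({s₁, s} : Finset ι), h i := by
      rw [Finset.sum_empty, sub_zero, zero_sub, Finset.sum_pair (Ne.symm hss₁), e, hs₁, hs, hpq]
      have key : τ - h p - h p - -(τ - h p + τ) = (τ + τ + τ) - (h p + h p + h p) := by abel
      rw [three, three, sub_zero] at key
      exact sub_eq_zero.mp key
    obtain ⟨-, h2⟩ := soloBlind_signed_sumDistinct three hdist hA (Finset.empty_subset B)
      (Finset.empty_subset B) (Finset.insert_subset hs₁B (Finset.singleton_subset_iff.mpr hsB))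
      (Finset.disjoint_empty_right A) (Finset.disjoint_empty_left _) e'
    have hmem : s₁ ∈ (∅ : Finset ι) := h2.symm ▸ Finset.mem_insert_self s₁ {s}
    exact Finset.notMem_empty s₁ hmem
  · -- `a ≠ b`: `∑A = h s₁ + h s₂ - h s`, i.e. `(A, ∅)` against `({s₁, s₂}, {s})`
    have e' : ∑ i ∈ A, h i - ∑ i ∈ (∅ : Finset ι), h i =
        ∑ i ∈ ({s₁, s₂} : Finset ι), h i - ∑ i ∈ ({s} : Finset ι), h i := by
      rw [Finset.sum_empty, sub_zero, Finset.sum_pair h₁₂, Finset.sum_singleton, e, hs₁, hs₂, hs]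
      abel
    have hdisj : Disjoint ({s₁, s₂} : Finset ι) {s} := by
      rw [Finset.disjoint_singleton_right]
      simp only [Finset.mem_insert, Finset.mem_singleton, not_or]
      exact ⟨hss₁, hss₂⟩
    obtain ⟨-, h2⟩ := soloBlind_signed_sumDistinct three hdist hA (Finset.empty_subset B)
      (Finset.insert_subset hs₁B (Finset.singleton_subset_iff.mpr hs₂B)) (Finset.singleton_subset_iff.mpr hsB)
      (Finset.disjoint_empty_right A) hdisj e'
    have hmem : s ∈ (∅ : Finset ι) := h2.symm ▸ Finset.mem_singleton_self s
    exact Finset.notMem_empty s hmem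

omit [DecidableEq G] in
/-- Pattern P5: values `h s = τ = h p + h q`, `h s₁ = τ - h p` on `B` together with a `B`-representation of
`τ - h q` is impossible (signed sum-distinctness). -/
theorem soloBlind_kill_P5 (three : ∀ g : G, g + g + g = 0) {h : ι → G} {B : Finset ι}
    (hdist : ∀ A ⊆ B, ∀ A' ⊆ B, ∑ i ∈ A, h i = ∑ i ∈ A', h i → A = A')
    {p q : ι} (ha : h p ≠ 0) {τ : G} {s s₁ : ι} (hsB : s ∈ B) (hs₁B : s₁ ∈ B)
    (hs : h s = τ) (hs₁ : h s₁ = τ - h p) (hτ : τ = h p + h q)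
    {A : Finset ι} (hA : A ⊆ B) (e : ∑ i ∈ A, h i = τ - h q) : False := by
  have hss₁ : s ≠ s₁ := by
    intro hss
    apply ha
    have e₁ := hs₁
    rw [← hss, hs] at e₁
    exact sub_eq_self.mp e₁.symm
  have e' : ∑ i ∈ A, h i - ∑ i ∈ (∅ : Finset ι), h i =
      ∑ i ∈ ({s} : Finset ι), h i - ∑ i ∈ ({s₁} : Finset ι), h i := by
    rw [Finset.sum_empty, sub_zero, Finset.sum_singleton, Finset.sum_singleton, e, hs, hs₁, hτ]
    abel
  obtain ⟨-, h2⟩ := soloBlind_signed_sumDistinct three hdist hA (Finset.empty_subset B)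
    (Finset.singleton_subset_iff.mpr hsB) (Finset.singleton_subset_iff.mpr hs₁B)
    (Finset.disjoint_empty_right A) (Finset.disjoint_singleton.mpr hss₁) e'
  have hmem : s₁ ∈ (∅ : Finset ι) := h2.symm ▸ Finset.mem_singleton_self s₁
  exact Finset.notMem_empty s₁ hmem

/-! ## Masses on a sum-distinct set -/

omit [DecidableEq ι] in
/-- On a sum-distinct `B`, if `A` represents `x` then `K_B(x) ≤ 2^{-n}` for every `n ≤ |A|`. -/
theorem soloBlind_mass_le_pow_of_rep {h : ι → G} {B : Finset ι}
    (hdist : ∀ A ⊆ B, ∀ A' ⊆ B, ∑ i ∈ A, h i = ∑ i ∈ A', h i → A = A') {x : G} {A : Finset ι}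
    (hA : A ∈ soloBlindSeqRepAll h B x) {n : ℕ} (hn : n ≤ A.card) :
    soloBlindMass h B x ≤ (1 / 2 : ℚ) ^ n :=
  soloBlind_mass_le_pow_of_card_le_one h B x n (soloBlind_repAll_card_le_one_of_sumDistinct hdist x)
    (fun T hT => by
      rw [Finset.card_le_one.mp (soloBlind_repAll_card_le_one_of_sumDistinct hdist x) T hT A hA]
      exact hn)

omit [DecidableEq ι] in
/-- On a sum-distinct `B` every mass is at most `1`. -/
theorem soloBlind_mass_le_one_of_sumDistinct {h : ι → G} {B : Finset ι}
    (hdist : ∀ A ⊆ B, ∀ A' ⊆ B, ∑ i ∈ A, h i = ∑ i ∈ A', h i → A = A') (x : G) :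
    soloBlindMass h B x ≤ 1 := by
  have e := soloBlind_mass_le_pow_of_card_le_one h B x 0
    (soloBlind_repAll_card_le_one_of_sumDistinct hdist x) (fun T _ => Nat.zero_le _)
  rwa [pow_zero] at e

omit [DecidableEq ι] in
/-- A target without representation has mass `0`. -/
theorem soloBlind_mass_eq_zero_of_repAll_eq_empty {h : ι → G} {B : Finset ι} {x : G}
    (h0 : soloBlindSeqRepAll h B x = ∅) : soloBlindMass h B x = 0 := by
  rw [soloBlindMass, h0, Finset.sum_empty]

end Summit.MatrixMultiplication.MatrixMultiplication.Theorems
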